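import Literature.NumberTheory.EllipticCurves.Sprung2012.ColemanMapLambdaActionProofs
import HarnessLib

/-!
# Sprung 2012, §2 / Def. 3.1 / Def. 5.9: the `Λ`-module structure of `H¹_Iw(T)` in the points model —
# `Λ = ℤ_p⟦T⟧` acting on the functionals `E(K_∞·K_v) →+ ℤ_p`, `T ↦ (· ∘ g⁻¹) − id` (DEFINITION with body)

Topic `Literature/NumberTheory/EllipticCurves`, cluster `Sprung2012` (namespace = path). In the tree's transcription of
Sprung's local Iwasawa theory (`Sprung2012/ColemanMaps.lean`) the Iwasawa cohomology `H¹_Iw(T)` of `T = T_pE` along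
`K_∞·K_v` IS the group of additive functionals `z : E(K_∞·K_v) →+ ℤ_p` (`localTowerPointsOfEmb κ ι W →+ ℤ_[p]`), but its
`Λ`-module structure — through which Sprung states that the Coleman map `Col : H¹_Iw(T) → Λ ⊕ Λ` is a homomorphism of
`Λ`-modules (§2 p. 1486: "`Λ = ℤ_p[Δ]⟦X⟧`, `γ ↦ 1 + X`"; Def. 5.9) — was so far only available EXISTENTIALLY
(`IsColemanPair.exists_mul`, file `ColemanMapLambdaActionProofs`). This file DEFINES it, with the construction of that proof:

* `twistEnd κ ι W g` — the twist `Θ_g : z ↦ z ∘ g⁻¹` as a `ℤ_p`-linear endomorphism (the body of `exists_twistEnd`);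
* `lambdaSMul κ ι W hg f z` — **the action of `f ∈ Λ` on a functional `z`**: on a point `y` of level `n`,
  `(f • z)(y) := (r(Θ_g − 1) z)(y)` for ANY polynomial `r ≡ f (mod ω_n)` (Weierstrass division,
  `exists_polynomial_toIwasawa_cyclotomicOmega_dvd_sub`), well defined because `ω_n(Θ_g − 1) = Θ_g^{pⁿ} − 1` kills the values on
  `E(K_n·K_v)` (`aeval_twistEnd_apply_eq_of_omega_dvd_sub`) and `E(K_∞·K_v) = ⋃ₙ E(K_n·K_v)`; `lambdaSMul_apply_eq_aeval` (the
  defining formula for every level and every representative), `lambdaSMul_coe_polynomial`, `lambdaSMul_X_apply`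
  (`(T • z)(y) = z(g⁻¹y) − z(y)`), `lambdaSMul_C` (`C a • z = a • z`);
* `moduleOfGenerator κ ι W hg : Module (IwasawaAlgebra p) (E(K_∞·K_v) →+ ℤ_p)` — a DEFINITION (to be activated with
  `letI`), NOT an instance: it depends on the local lift `g` of the topological generator (`κ(res g) = 1`), exactly as
  `IwasawaDual.IsLocNil.module` does on the dual side;
* `isColemanPair_lambdaSMul` — **`Col(f • z) = f · Col(z)`**: Sprung's Def. 5.9 "`Col` is `Λ`-linear" as a theorem about the
  DEFINED action (the computation of `IsColemanPair.exists_mul`).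

Consumers: the K3 line `colemanrat` v5 of crux `SignedKatoDivisibilityUpToAtTwo` (stub (R2^ι) needs an honest `Λ`-module `P =
H¹_Iw ⧸ Ker Col♭`), the `bsd-2adic` ♭ package at `p = 2`. Generic: any `K`, `p`, `ℤ_p`-extension `κ`, place (`ι : K̄ → K̄_v`), `W`.
Typed ≠ endorsed; nothing about any curve is asserted; BSD is not proved by any of this.

## References
* [Sprung2012] F. E. I. Sprung, J. Number Theory 132 (2012) 1483–1506: §2 p. 1486, Def. 3.1 (p. 1489), Def. 5.9 (p. 1495), Lemma 7.10.
* [Washington1997] L. C. Washington, *Introduction to Cyclotomic Fields*, §7.1, Prop. 7.2, Thm. 7.1 (`Λ ≅ lim← ℤ_p[X]/(ω_n)`), §13.2.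
-/

noncomputable section

open scoped Classical

open Polynomial

universe u

namespace Literature.NumberTheory.EllipticCurves.Sprung2012

open Literature.NumberTheory.EllipticCurves Literature.NumberTheory.GaloisRepresentations ZpExtension
  Literature.NumberTheory.EllipticCurves.Kobayashi2003 Literature.NumberTheory.EllipticCurves.Sprung2017
  Literature.NumberTheory.EllipticCurves.Kato2004

section Local

variable {K : Type u} [Field K] {p : ℕ} [Fact p.Prime] (κ : ZpExtension K p)
variable {E : Type u} [Field E] [Algebra K E] (ι : AlgebraicClosure K →ₐ[K] AlgebraicClosure E)
variable (W : WeierstrassCurve K)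

/-! ## §1 The twist endomorphism `Θ_g : z ↦ z ∘ g⁻¹` -/

/-- **The twist `Θ_g z = z ∘ g⁻¹`** of a functional on `E(K_∞·K_v)` (which is `Γ_{K_v}`-stable), as a `ℤ_p`-linear
endomorphism — the action of `γ ↦ 1 + T` (Sprung §2 p. 1486, Def. 3.1); the body of `exists_twistEnd`.
[cite: Sprung2012, §2 p. 1486 and Def. 3.1 (p. 1489)] -/
def twistEnd (g : Field.absoluteGaloisGroup E) : Module.End ℤ_[p] (localTowerPointsOfEmb κ ι W →+ ℤ_[p]) where
  toFun z := z.comp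
    { toFun := fun y ↦ ⟨g⁻¹ • (y : localPoints W E), smul_mem_localTowerPointsOfEmb κ ι W g⁻¹ y.2⟩
      map_zero' := Subtype.ext (by simp)
      map_add' := fun a b ↦ Subtype.ext (by simp [smul_add]) }
  map_add' z z' := AddMonoidHom.ext fun _ ↦ rfl
  map_smul' a z := AddMonoidHom.ext fun _ ↦ rfl

/-- `Θ_g z y = z (g⁻¹ y)` (unfolding). [cite: Sprung2012, Def. 3.1 (p. 1489)] -/
@[simp] theorem twistEnd_apply (g : Field.absoluteGaloisGroup E) (z : localTowerPointsOfEmb κ ι W →+ ℤ_[p])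
    (y : localTowerPointsOfEmb κ ι W) :
    twistEnd κ ι W g z y = z ⟨g⁻¹ • (y : localPoints W E), smul_mem_localTowerPointsOfEmb κ ι W g⁻¹ y.2⟩ :=
  rfl

/-! ## §2 The action of `Λ`: values on a point of level `n` through a polynomial representative modulo `ω_n` -/

/-- A chosen level of a tower point (`E(K_∞·K_v) = ⋃ₙ E(K_n·K_v)`). [cite: Sprung2012, Lemma 7.10 (p. 1503)] -/
def level (y : localTowerPointsOfEmb κ ι W) : ℕ :=
  Classical.choose (exists_mem_localLayerPointsOfEmb_of_mem_localTowerPointsOfEmb κ ι W y.2)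

/-- The point lies in its chosen layer. [cite: Sprung2012, Lemma 7.10 (p. 1503)] -/
theorem mem_layer_level (y : localTowerPointsOfEmb κ ι W) :
    (y : localPoints W E) ∈ localLayerPointsOfEmb κ ι W (level κ ι W y) :=
  Classical.choose_spec (exists_mem_localLayerPointsOfEmb_of_mem_localTowerPointsOfEmb κ ι W y.2)

variable {κ ι W}

variable (p) in
/-- A chosen polynomial representative of `f ∈ Λ` modulo `ω_n` (Weierstrass division, Washington Prop. 7.2).
[cite: Washington1997, Prop. 7.2] -/
def polyRep (n : ℕ) (f : IwasawaAlgebra p) : ℤ_[p][X] :=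
  Classical.choose (exists_polynomial_toIwasawa_cyclotomicOmega_dvd_sub p n f)

/-- `ω_n ∣ f − polyRep n f` in `Λ`. [cite: Washington1997, Prop. 7.2] -/
theorem toIwasawa_dvd_sub_polyRep (n : ℕ) (f : IwasawaAlgebra p) :
    toIwasawa p (cyclotomicOmega p n) ∣ f - (polyRep p n f : PowerSeries ℤ_[p]) :=
  Classical.choose_spec (exists_polynomial_toIwasawa_cyclotomicOmega_dvd_sub p n f)

/-- Two representatives of `f` modulo `ω_m` and `ω_n`, `m ≤ n`, are congruent modulo `ω_m` in `ℤ_p[X]`.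
[cite: Washington1997, Prop. 7.2 and Thm. 7.1] -/
theorem omega_dvd_sub_of_reps {m n : ℕ} (hmn : m ≤ n) {f : IwasawaAlgebra p} {r r' : ℤ_[p][X]}
    (hr : toIwasawa p (cyclotomicOmega p m) ∣ f - (r : PowerSeries ℤ_[p]))
    (hr' : toIwasawa p (cyclotomicOmega p n) ∣ f - (r' : PowerSeries ℤ_[p])) :
    ((X + 1 : ℤ_[p][X]) ^ p ^ m - 1) ∣ r - r' := by
  refine omega_dvd_of_coe_dvd ?_
  rw [← toIwasawa_cyclotomicOmega_eq_coe, Polynomial.coe_sub,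
    show ((r : ℤ_[p][X]) : PowerSeries ℤ_[p]) - ((r' : ℤ_[p][X]) : PowerSeries ℤ_[p]) =
      (f - ((r' : ℤ_[p][X]) : PowerSeries ℤ_[p])) - (f - ((r : ℤ_[p][X]) : PowerSeries ℤ_[p])) by ring]
  exact dvd_sub ((map_dvd (toIwasawa p) (cyclotomicOmega_dvd_cyclotomicOmega_of_le p hmn)).trans hr') hr

variable {g : Field.absoluteGaloisGroup E}

/-- **Independence of the level and of the representative**: for `x` in the layers `m` and `n` and representatives
`r ≡ f (mod ω_m)`, `r' ≡ f (mod ω_n)`, the values `(r(Θ_g − 1) z)(x)` and `(r'(Θ_g − 1) z)(x)` agree.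
[cite: Sprung2012, §2 p. 1486 and Def. 3.1 (p. 1489)] -/
theorem aeval_twistEnd_apply_eq_of_reps (hg : κ.IsTopGenerator (resGalOfEmb ι g)) {m n : ℕ} {f : IwasawaAlgebra p}
    {r r' : ℤ_[p][X]} (hr : toIwasawa p (cyclotomicOmega p m) ∣ f - (r : PowerSeries ℤ_[p]))
    (hr' : toIwasawa p (cyclotomicOmega p n) ∣ f - (r' : PowerSeries ℤ_[p]))
    (z : localTowerPointsOfEmb κ ι W →+ ℤ_[p]) {x : localPoints W E}
    (hm : x ∈ localLayerPointsOfEmb κ ι W m) (hn : x ∈ localLayerPointsOfEmb κ ι W n) :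
    (aeval (twistEnd κ ι W g - 1) r z) ⟨x, localLayerPointsOfEmb_le_localTowerPointsOfEmb κ ι W m hm⟩ =
      (aeval (twistEnd κ ι W g - 1) r' z) ⟨x, localLayerPointsOfEmb_le_localTowerPointsOfEmb κ ι W n hn⟩ := by
  wlog hmn : m ≤ n generalizing m n r r'
  · exact (this hr' hr hn hm (le_of_not_ge hmn)).symm
  exact aeval_twistEnd_apply_eq_of_omega_dvd_sub hg (twistEnd_apply κ ι W g) (omega_dvd_sub_of_reps hmn hr hr') z hm

variable (κ ι W)

/-- **The action of `f ∈ Λ` on a functional** `z : E(K_∞·K_v) →+ ℤ_p`: `(f • z)(y) = (r(Θ_g − 1) z)(y)` with `r ≡ f (mod ω_n)`,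
`n` the (chosen) level of `y` — independent of the choices (`aeval_twistEnd_apply_eq_of_reps`), additive in `y`
(`exists_mem_localLayerPointsOfEmb_pair`). [cite: Sprung2012, §2 p. 1486, Def. 3.1 (p. 1489) and Def. 5.9 (p. 1495)] -/
def lambdaSMul (hg : κ.IsTopGenerator (resGalOfEmb ι g)) (f : IwasawaAlgebra p) (z : localTowerPointsOfEmb κ ι W →+ ℤ_[p]) :
    localTowerPointsOfEmb κ ι W →+ ℤ_[p] where
  toFun y := (aeval (twistEnd κ ι W g - 1) (polyRep p (level κ ι W y) f) z) y
  map_zero' := by rw [map_zero]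
  map_add' x y := by
    obtain ⟨N, hx, hy⟩ := exists_mem_localLayerPointsOfEmb_pair κ ι W x.2 y.2
    have ex := aeval_twistEnd_apply_eq_of_reps hg (toIwasawa_dvd_sub_polyRep (level κ ι W x) f)
      (toIwasawa_dvd_sub_polyRep N f) z (mem_layer_level κ ι W x) hx
    have ey := aeval_twistEnd_apply_eq_of_reps hg (toIwasawa_dvd_sub_polyRep (level κ ι W y) f)
      (toIwasawa_dvd_sub_polyRep N f) z (mem_layer_level κ ι W y) hy
    have exy := aeval_twistEnd_apply_eq_of_reps hg (toIwasawa_dvd_sub_polyRep (level κ ι W (x + y)) f)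
      (toIwasawa_dvd_sub_polyRep N f) z (mem_layer_level κ ι W (x + y)) (add_mem hx hy)
    change (aeval (twistEnd κ ι W g - 1) (polyRep p (level κ ι W (x + y)) f) z) (x + y) =
      (aeval (twistEnd κ ι W g - 1) (polyRep p (level κ ι W x) f) z) x +
        (aeval (twistEnd κ ι W g - 1) (polyRep p (level κ ι W y) f) z) y
    rw [ex, ey, exy, ← map_add]

variable {κ ι W}

/-- **The defining formula at any level with any representative**: for `x ∈ E(K_n·K_v)` and `r ≡ f (mod ω_n)`,
`(f • z)(x) = (r(Θ_g − 1) z)(x)`. [cite: Sprung2012, §2 p. 1486 and Def. 3.1 (p. 1489)] -/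
theorem lambdaSMul_apply_eq_aeval (hg : κ.IsTopGenerator (resGalOfEmb ι g)) (f : IwasawaAlgebra p)
    (z : localTowerPointsOfEmb κ ι W →+ ℤ_[p]) {n : ℕ} {r : ℤ_[p][X]}
    (hr : toIwasawa p (cyclotomicOmega p n) ∣ f - (r : PowerSeries ℤ_[p])) {x : localPoints W E}
    (hx : x ∈ localLayerPointsOfEmb κ ι W n) :
    lambdaSMul κ ι W hg f z ⟨x, localLayerPointsOfEmb_le_localTowerPointsOfEmb κ ι W n hx⟩ =
      (aeval (twistEnd κ ι W g - 1) r z) ⟨x, localLayerPointsOfEmb_le_localTowerPointsOfEmb κ ι W n hx⟩ := by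
  have hxT : x ∈ localTowerPointsOfEmb κ ι W := localLayerPointsOfEmb_le_localTowerPointsOfEmb κ ι W n hx
  have h := aeval_twistEnd_apply_eq_of_reps hg (toIwasawa_dvd_sub_polyRep (level κ ι W ⟨x, hxT⟩) f) hr z
    (mem_layer_level κ ι W ⟨x, hxT⟩) hx
  exact h

/-- Two functionals agreeing on the layer `E(K_n·K_v)` have `r(Θ_g − 1)`-images agreeing there (the layer is
`Γ_{K_v}`-stable; `aeval_twistEnd_apply_eq_zero_of_forall` for the difference). [cite: Sprung2012, Def. 3.1 (p. 1489)] -/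
theorem aeval_twistEnd_apply_congr {n : ℕ} {w w' : localTowerPointsOfEmb κ ι W →+ ℤ_[p]}
    (h : ∀ (y : localPoints W E) (hy : y ∈ localLayerPointsOfEmb κ ι W n),
      w ⟨y, localLayerPointsOfEmb_le_localTowerPointsOfEmb κ ι W n hy⟩ =
        w' ⟨y, localLayerPointsOfEmb_le_localTowerPointsOfEmb κ ι W n hy⟩)
    (r : ℤ_[p][X]) {x : localPoints W E} (hx : x ∈ localLayerPointsOfEmb κ ι W n) :
    (aeval (twistEnd κ ι W g - 1) r w) ⟨x, localLayerPointsOfEmb_le_localTowerPointsOfEmb κ ι W n hx⟩ =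
      (aeval (twistEnd κ ι W g - 1) r w') ⟨x, localLayerPointsOfEmb_le_localTowerPointsOfEmb κ ι W n hx⟩ := by
  rw [← sub_eq_zero, ← AddMonoidHom.sub_apply, ← map_sub]
  exact aeval_twistEnd_apply_eq_zero_of_forall (twistEnd_apply κ ι W g)
    (fun y hy ↦ by rw [AddMonoidHom.sub_apply, h y hy, sub_self]) r x hx

/-- On a polynomial the action is the honest one: `(r : Λ) • z = r(Θ_g − 1) z`. [cite: Sprung2012, Def. 3.1 (p. 1489)] -/
theorem lambdaSMul_coe_polynomial (hg : κ.IsTopGenerator (resGalOfEmb ι g)) (r : ℤ_[p][X])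
    (z : localTowerPointsOfEmb κ ι W →+ ℤ_[p]) :
    lambdaSMul κ ι W hg (r : PowerSeries ℤ_[p]) z = aeval (twistEnd κ ι W g - 1) r z := by
  ext y
  obtain ⟨n, hn⟩ := exists_mem_localLayerPointsOfEmb_of_mem_localTowerPointsOfEmb κ ι W y.2
  exact lambdaSMul_apply_eq_aeval hg _ z (r := r) (by rw [sub_self]; exact dvd_zero _) hn

/-- `1 • z = z`. [cite: Sprung2012, Def. 5.9 (p. 1495)] -/
theorem one_lambdaSMul (hg : κ.IsTopGenerator (resGalOfEmb ι g)) (z : localTowerPointsOfEmb κ ι W →+ ℤ_[p]) :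
    lambdaSMul κ ι W hg 1 z = z := by
  have h := lambdaSMul_coe_polynomial hg (1 : ℤ_[p][X]) z
  rwa [Polynomial.coe_one, map_one, Module.End.one_apply] at h

/-- `0 • z = 0`. [cite: Sprung2012, Def. 5.9 (p. 1495)] -/
theorem zero_lambdaSMul (hg : κ.IsTopGenerator (resGalOfEmb ι g)) (z : localTowerPointsOfEmb κ ι W →+ ℤ_[p]) :
    lambdaSMul κ ι W hg 0 z = 0 := by
  have h := lambdaSMul_coe_polynomial hg (0 : ℤ_[p][X]) z
  rwa [Polynomial.coe_zero, map_zero, LinearMap.zero_apply] at h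

/-- `f • 0 = 0`. [cite: Sprung2012, Def. 5.9 (p. 1495)] -/
theorem lambdaSMul_zero (hg : κ.IsTopGenerator (resGalOfEmb ι g)) (f : IwasawaAlgebra p) :
    lambdaSMul κ ι W hg f (0 : localTowerPointsOfEmb κ ι W →+ ℤ_[p]) = 0 := by
  ext y
  obtain ⟨n, hn⟩ := exists_mem_localLayerPointsOfEmb_of_mem_localTowerPointsOfEmb κ ι W y.2
  have h := lambdaSMul_apply_eq_aeval hg f (0 : localTowerPointsOfEmb κ ι W →+ ℤ_[p]) (toIwasawa_dvd_sub_polyRep n f) hn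
  rw [map_zero] at h
  exact h

/-- `f • (z + z') = f • z + f • z'`. [cite: Sprung2012, Def. 5.9 (p. 1495)] -/
theorem lambdaSMul_add (hg : κ.IsTopGenerator (resGalOfEmb ι g)) (f : IwasawaAlgebra p)
    (z z' : localTowerPointsOfEmb κ ι W →+ ℤ_[p]) :
    lambdaSMul κ ι W hg f (z + z') = lambdaSMul κ ι W hg f z + lambdaSMul κ ι W hg f z' := by
  ext y
  obtain ⟨n, hn⟩ := exists_mem_localLayerPointsOfEmb_of_mem_localTowerPointsOfEmb κ ι W y.2
  have hr := toIwasawa_dvd_sub_polyRep n f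
  change lambdaSMul κ ι W hg f (z + z') ⟨y, _⟩ = lambdaSMul κ ι W hg f z ⟨y, _⟩ + lambdaSMul κ ι W hg f z' ⟨y, _⟩
  rw [lambdaSMul_apply_eq_aeval hg f _ hr hn, lambdaSMul_apply_eq_aeval hg f _ hr hn, lambdaSMul_apply_eq_aeval hg f _ hr hn,
    map_add, AddMonoidHom.add_apply]

/-- `(f + f') • z = f • z + f' • z`. [cite: Sprung2012, Def. 5.9 (p. 1495)] -/
theorem add_lambdaSMul (hg : κ.IsTopGenerator (resGalOfEmb ι g)) (f f' : IwasawaAlgebra p)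
    (z : localTowerPointsOfEmb κ ι W →+ ℤ_[p]) :
    lambdaSMul κ ι W hg (f + f') z = lambdaSMul κ ι W hg f z + lambdaSMul κ ι W hg f' z := by
  ext y
  obtain ⟨n, hn⟩ := exists_mem_localLayerPointsOfEmb_of_mem_localTowerPointsOfEmb κ ι W y.2
  have hr := toIwasawa_dvd_sub_polyRep n f
  have hr' := toIwasawa_dvd_sub_polyRep n f'
  have hsum : toIwasawa p (cyclotomicOmega p n) ∣ (f + f') - ((polyRep p n f + polyRep p n f' : ℤ_[p][X]) : PowerSeries ℤ_[p]) := by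
    rw [Polynomial.coe_add, show f + f' - (((polyRep p n f : ℤ_[p][X]) : PowerSeries ℤ_[p]) + ((polyRep p n f' : ℤ_[p][X]) : PowerSeries ℤ_[p])) =
      (f - ((polyRep p n f : ℤ_[p][X]) : PowerSeries ℤ_[p])) + (f' - ((polyRep p n f' : ℤ_[p][X]) : PowerSeries ℤ_[p])) by ring]
    exact dvd_add hr hr'
  change lambdaSMul κ ι W hg (f + f') z ⟨y, _⟩ = lambdaSMul κ ι W hg f z ⟨y, _⟩ + lambdaSMul κ ι W hg f' z ⟨y, _⟩
  rw [lambdaSMul_apply_eq_aeval hg _ z hsum hn, lambdaSMul_apply_eq_aeval hg f z hr hn,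
    lambdaSMul_apply_eq_aeval hg f' z hr' hn, map_add, LinearMap.add_apply, AddMonoidHom.add_apply]

/-- `(f * f') • z = f • (f' • z)`. [cite: Sprung2012, Def. 5.9 (p. 1495)] -/
theorem mul_lambdaSMul (hg : κ.IsTopGenerator (resGalOfEmb ι g)) (f f' : IwasawaAlgebra p)
    (z : localTowerPointsOfEmb κ ι W →+ ℤ_[p]) :
    lambdaSMul κ ι W hg (f * f') z = lambdaSMul κ ι W hg f (lambdaSMul κ ι W hg f' z) := by
  ext y
  obtain ⟨n, hn⟩ := exists_mem_localLayerPointsOfEmb_of_mem_localTowerPointsOfEmb κ ι W y.2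
  have hr := toIwasawa_dvd_sub_polyRep n f
  have hr' := toIwasawa_dvd_sub_polyRep n f'
  have hprod : toIwasawa p (cyclotomicOmega p n) ∣ (f * f') - ((polyRep p n f * polyRep p n f' : ℤ_[p][X]) : PowerSeries ℤ_[p]) := by
    rw [Polynomial.coe_mul, show f * f' - ((polyRep p n f : ℤ_[p][X]) : PowerSeries ℤ_[p]) * ((polyRep p n f' : ℤ_[p][X]) : PowerSeries ℤ_[p]) =
      (f - ((polyRep p n f : ℤ_[p][X]) : PowerSeries ℤ_[p])) * f' +
        ((polyRep p n f : ℤ_[p][X]) : PowerSeries ℤ_[p]) * (f' - ((polyRep p n f' : ℤ_[p][X]) : PowerSeries ℤ_[p])) by ring]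
    exact dvd_add (dvd_mul_of_dvd_left hr _) (dvd_mul_of_dvd_right hr' _)
  change lambdaSMul κ ι W hg (f * f') z ⟨y, _⟩ = lambdaSMul κ ι W hg f (lambdaSMul κ ι W hg f' z) ⟨y, _⟩
  rw [lambdaSMul_apply_eq_aeval hg _ z hprod hn, lambdaSMul_apply_eq_aeval hg f _ hr hn, map_mul, Module.End.mul_apply]
  -- `r(Θ−1) (f' • z)` and `r(Θ−1) (r'(Θ−1) z)` agree at `y`, since `f' • z = r'(Θ−1) z` on the layer
  exact (aeval_twistEnd_apply_congr (fun x hx ↦ lambdaSMul_apply_eq_aeval hg f' z hr' hx) (polyRep p n f) hn).symm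

variable (κ ι W)

/-- **The `Λ`-module `H¹_Iw(T)` in the points model** (Sprung §2 / Def. 5.9): the functionals `E(K_∞·K_v) →+ ℤ_p` with the
action `lambdaSMul` attached to a local lift `g` of the topological generator (`κ(res g) = 1`, `g ↦ 1 + T`). A DEFINITION to be
activated with `letI` — NOT an instance (it depends on `g`), like `IwasawaDual.IsLocNil.module` on the dual side.
[cite: Sprung2012, §2 p. 1486 and Def. 5.9 (p. 1495)] [cite: Washington1997, §13.2] -/
@[reducible] def moduleOfGenerator (hg : κ.IsTopGenerator (resGalOfEmb ι g)) :
    Module (IwasawaAlgebra p) (localTowerPointsOfEmb κ ι W →+ ℤ_[p]) where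
  smul := lambdaSMul κ ι W hg
  one_smul := one_lambdaSMul hg
  mul_smul := mul_lambdaSMul hg
  smul_zero := lambdaSMul_zero hg
  smul_add := lambdaSMul_add hg
  add_smul := add_lambdaSMul hg
  zero_smul := zero_lambdaSMul hg

variable {κ ι W}

/-- Unfolding the `smul` of `moduleOfGenerator`. [cite: Sprung2012, Def. 5.9 (p. 1495)] -/
theorem moduleOfGenerator_smul_eq (hg : κ.IsTopGenerator (resGalOfEmb ι g)) (f : IwasawaAlgebra p)
    (z : localTowerPointsOfEmb κ ι W →+ ℤ_[p]) :
    (letI := moduleOfGenerator κ ι W hg; f • z) = lambdaSMul κ ι W hg f z :=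
  rfl

/-! ## §3 `T` and the constants; the Coleman map is `Λ`-linear for this action -/

/-- **`(T • z)(y) = z(g⁻¹ y) − z(y)`**: `T` acts as `Θ_g − 1` (`γ ↦ 1 + T`). [cite: Sprung2012, §2 p. 1486] -/
theorem lambdaSMul_X_apply (hg : κ.IsTopGenerator (resGalOfEmb ι g)) (z : localTowerPointsOfEmb κ ι W →+ ℤ_[p])
    (y : localTowerPointsOfEmb κ ι W) :
    lambdaSMul κ ι W hg (PowerSeries.X : IwasawaAlgebra p) z y =
      z ⟨g⁻¹ • (y : localPoints W E), smul_mem_localTowerPointsOfEmb κ ι W g⁻¹ y.2⟩ - z y := by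
  have h := lambdaSMul_coe_polynomial hg (X : ℤ_[p][X]) z
  rw [Polynomial.coe_X] at h
  rw [h, aeval_X, LinearMap.sub_apply, Module.End.one_apply, AddMonoidHom.sub_apply, twistEnd_apply]

/-- **`C a • z = a • z`**: the constants act through `ℤ_p`. [cite: Sprung2012, §2 p. 1486] -/
theorem lambdaSMul_C (hg : κ.IsTopGenerator (resGalOfEmb ι g)) (a : ℤ_[p]) (z : localTowerPointsOfEmb κ ι W →+ ℤ_[p]) :
    lambdaSMul κ ι W hg (PowerSeries.C a : IwasawaAlgebra p) z = a • z := by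
  have h := lambdaSMul_coe_polynomial hg (Polynomial.C a : ℤ_[p][X]) z
  rw [Polynomial.coe_C] at h
  rw [h, aeval_C, Module.algebraMap_end_apply]

/-- **`Col(f • z) = f · Col(z)`** — Sprung's Def. 5.9 «`Col : H¹_Iw(T) → Λ ⊕ Λ` is a homomorphism of `Λ`-modules» for the
DEFINED action (levels `c_n ∈ E(K_n·K_v)`; any `ap`): at level `n`, `f • z` agrees on `E(K_n·K_v)` with `r_n(Θ_g − 1) z`, so
`P_{n,c_n}(f • z) = P_{n,c_n}(r_n(Θ_g−1) z) ≡ r_n · P_{n,c_n}(z) ≡ f · P_{n,c_n}(z)` modulo `ω_n` (`IsColemanPair.aeval_twistEnd`).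
[cite: Sprung2012, Def. 5.9 (p. 1495), Def. 3.1 (p. 1489)] -/
theorem isColemanPair_lambdaSMul (hg : κ.IsTopGenerator (resGalOfEmb ι g)) {ap : ℤ} {c : ℕ → localPoints W E}
    (hc : ∀ n, c n ∈ localLayerPointsOfEmb κ ι W n) {z : localTowerPointsOfEmb κ ι W →+ ℤ_[p]} {Ls Lf : IwasawaAlgebra p}
    (h : IsColemanPair κ ι W ap g c z Ls Lf) (f : IwasawaAlgebra p) :
    IsColemanPair κ ι W ap g c (lambdaSMul κ ι W hg f z) (f * Ls) (f * Lf) := by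
  have hle := fun n ↦ localLayerPointsOfEmb_le_localTowerPointsOfEmb κ ι W n
  intro n
  set r := polyRep p n f with hrdef
  have hr : toIwasawa p (cyclotomicOmega p n) ∣ f - (r : PowerSeries ℤ_[p]) := toIwasawa_dvd_sub_polyRep n f
  have hcn : ∀ j : ℕ, g ^ j • c n ∈ localLayerPointsOfEmb κ ι W n := fun j ↦ smul_mem_localLayerPointsOfEmb κ ι W n _ (hc n)
  have hP : pairingSum W (localTowerPointsOfEmb κ ι W) g n (c n) (lambdaSMul κ ι W hg f z) =
      pairingSum W (localTowerPointsOfEmb κ ι W) g n (c n) (aeval (twistEnd κ ι W g - 1) r z) := by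
    refine pairingSum_congr W _ g n (c n) fun j _ ↦ ?_
    rw [evalOn_of_mem W _ _ (hle n (hcn j)), evalOn_of_mem W _ _ (hle n (hcn j))]
    exact lambdaSMul_apply_eq_aeval hg f z hr (hcn j)
  rw [hP]
  have hpoly := (h.aeval_twistEnd hg hc (twistEnd_apply κ ι W g) r) n
  have hd : toIwasawa p (cyclotomicOmega p n) ∣
      (toIwasawa p (sharpPoly ap p n) * (f * Ls) + toIwasawa p (flatPoly ap p n) * (f * Lf)) -
        (toIwasawa p (sharpPoly ap p n) * ((r : PowerSeries ℤ_[p]) * Ls) +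
          toIwasawa p (flatPoly ap p n) * ((r : PowerSeries ℤ_[p]) * Lf)) := by
    have e : (toIwasawa p (sharpPoly ap p n) * (f * Ls) + toIwasawa p (flatPoly ap p n) * (f * Lf)) -
        (toIwasawa p (sharpPoly ap p n) * ((r : PowerSeries ℤ_[p]) * Ls) +
          toIwasawa p (flatPoly ap p n) * ((r : PowerSeries ℤ_[p]) * Lf)) =
        (f - (r : PowerSeries ℤ_[p])) * (toIwasawa p (sharpPoly ap p n) * Ls + toIwasawa p (flatPoly ap p n) * Lf) := by ring
    rw [e]
    exact dvd_mul_of_dvd_left hr _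
  have := dvd_add hpoly hd
  convert this using 1
  ring

end Local

end Literature.NumberTheory.EllipticCurves.Sprung2012

end
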